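import Mathlib
import Literature.NumberTheory.Transcendental.KZRulesAssociator
import Literature.NumberTheory.Transcendental.KZPeriodsProofs
import Literature.NumberTheory.Transcendental.KZSemialgebraicComplex
import Literature.NumberTheory.Transcendental.SemialgebraicLineDeriv
import HarnessLib

/-!
# Solo-informed: the algebra structure of the KZ formal period ring over the real algebraic numbers

Session s9 of the soloist line `solo-KontsevichZagierPeriods-informed` (file A of the Rung-2 plan,
`paper/rung2-v2.md` §4.2). The KZ formal period ring `P := KZ.FormalPeriodRing = FormalRep ⧸ relations`
(a commutative ring, `KZRulesAssociator.lean`) is made an algebra over the field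
`F_ℝ := algebraicClosure ℚ ℝ` of real algebraic numbers: `a ↦ ⟦[pt, a]⟧`, the class of the
0-dimensional representation with integrand the constant `a`. The ring axioms of this map are KZ
moves: additivity of the integrand (`[pt, a + b] ≡ [pt, a] + [pt, b]`) and the Fubini product
(`[pt, a] · [pt, b] = [pt × pt, a b]`). The key computation is
`⟦[pt, a]⟧ · ⟦[σ, f]⟧ = ⟦[σ, a • f]⟧` (`soloInformed_algScalar_mul_toFormalPeriod_of`): scaling an
integrand by a real algebraic constant is multiplication by a scalar in `P`.

On top of this, `V := P × P` ("real and imaginary part") is made a module over the field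
`F_ℂ := algebraicClosure ℚ ℂ` of complex algebraic numbers by
`a ⋆ (u, v) := (Re a • u − Im a • v, Im a • u + Re a • v)`; this is the target of the KZ-valued
functional `κ` on Huber–Wüstholz period symbols (files B, C of the plan).

References: M. Kontsevich, D. Zagier, *Periods* (2001), §1.1–1.2, §4.1 [KontsevichZagier2001];
A. Huber, G. Wüstholz, *Transcendence and linear relations of 1-periods* (2022), Ch. 13 [HuberWuestholz2022].
-/

noncomputable section

open MeasureTheory Set
open Literature.NumberTheory.Transcendental Literature.NumberTheory.Transcendental.KZ
open Literature.ModelTheory.ExponentialFields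

namespace Summit.KontsevichZagierPeriods.KontsevichZagierPeriods.Theorems

/-! ## 1. Constant representations `[pt, a]` and scaled representations `[σ, a • f]` -/

/-- **The constant representation `[pt, a]`** of a real algebraic number `a`: domain the point
`ℝ⁰`, integrand the constant `a`. [Kontsevich–Zagier 2001, §1.1] -/
def soloInformedConstRep (a : ℝ) (ha : IsAlgebraic ℚ a) : IntegralRep 0 where
  domain := univ
  integrand := fun _ => a
  isSemialgebraic_domain := isSemialgebraic_univ
  isSemialgebraicFunOn_integrand := isSemialgebraicFunOn_const_of_isAlgebraic isSemialgebraic_univ ha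
  integrableOn := integrableOn_const (hs := by simp [volume_univ_fin_zero])
/-- The domain of `[pt, a]` is `ℝ⁰` (definitional). -/
@[simp] theorem soloInformedConstRep_domain (a : ℝ) (ha : IsAlgebraic ℚ a) :
    (soloInformedConstRep a ha).domain = univ := rfl
/-- The integrand of `[pt, a]` is the constant `a` (definitional). -/
@[simp] theorem soloInformedConstRep_integrand (a : ℝ) (ha : IsAlgebraic ℚ a) :
    (soloInformedConstRep a ha).integrand = fun _ => a := rfl

/-- `[pt, 1]` is the unit representation. -/
theorem soloInformedConstRep_one : soloInformedConstRep 1 isAlgebraic_one = IntegralRep.unit :=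
  IntegralRep.ext' rfl rfl
/-- `value [pt, a] = a`. -/
@[simp] theorem soloInformedConstRep_value (a : ℝ) (ha : IsAlgebraic ℚ a) :
    (soloInformedConstRep a ha).value = a := by
  simp [IntegralRep.value, Measure.restrict_univ, measureReal_def, volume_univ_fin_zero]

/-- **The scaled representation `[σ, a • f]`**: same domain, integrand multiplied by the real
algebraic constant `a`. [Kontsevich–Zagier 2001, §1.2] -/
def soloInformedScaleRep {n : ℕ} (a : ℝ) (ha : IsAlgebraic ℚ a) (r : IntegralRep n) :
    IntegralRep n where
  domain := r.domain
  integrand := fun x => a * r.integrand x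
  isSemialgebraic_domain := r.isSemialgebraic_domain
  isSemialgebraicFunOn_integrand :=
    (isSemialgebraicFunOn_const_of_isAlgebraic r.isSemialgebraic_domain ha).fun_mul
      r.isSemialgebraicFunOn_integrand
  integrableOn := r.integrableOn.const_mul a
/-- The domain of `[σ, a • f]` is `σ` (definitional). -/
@[simp] theorem soloInformedScaleRep_domain {n : ℕ} (a : ℝ) (ha : IsAlgebraic ℚ a)
    (r : IntegralRep n) : (soloInformedScaleRep a ha r).domain = r.domain := rfl
/-- The integrand of `[σ, a • f]` is `x ↦ a * f x` (definitional). -/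
@[simp] theorem soloInformedScaleRep_integrand {n : ℕ} (a : ℝ) (ha : IsAlgebraic ℚ a)
    (r : IntegralRep n) : (soloInformedScaleRep a ha r).integrand = fun x => a * r.integrand x := rfl

/-- `[pt, a] · [σ, f]` is a relabelling of `[σ, a • f]` along `Fin n ≃ Fin (0 + n)` (equality of
representations; compare `IntegralRep.unit_prod_eq_reindex`). -/
theorem soloInformedConstRep_prod_eq_reindex {n : ℕ} (a : ℝ) (ha : IsAlgebraic ℚ a)
    (r : IntegralRep n) :
    (soloInformedConstRep a ha).prod r =
      (soloInformedScaleRep a ha r).reindex (finCongr (Nat.zero_add n).symm) := by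
  have hcoord : ∀ (w : Fin (0 + n) → ℝ),
      (fun j => w (Fin.natAdd 0 j)) = fun i => w (finCongr (Nat.zero_add n).symm i) := by
    intro w; funext j; simp
  refine IntegralRep.ext' ?_ ?_
  · ext w
    simp only [IntegralRep.prod_domain, IntegralRep.mem_prodDomain, soloInformedConstRep_domain,
      mem_univ, true_and, IntegralRep.reindex_domain, mem_setOf_eq, hcoord,
      soloInformedScaleRep_domain]
  · rw [IntegralRep.prod_integrand_eq, IntegralRep.reindex_integrand]
    funext w
    rw [IntegralRep.prodFun_apply, soloInformedConstRep_integrand, soloInformedScaleRep_integrand,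
      hcoord]

/-- `[pt, a] · [pt, b] = [pt, a b]` as representations (the relabelling `Fin 0 ≃ Fin (0 + 0)` is
the identity). -/
theorem soloInformedConstRep_prod_constRep (a b : ℝ) (ha : IsAlgebraic ℚ a) (hb : IsAlgebraic ℚ b) :
    (soloInformedConstRep a ha).prod (soloInformedConstRep b hb) =
      soloInformedConstRep (a * b) (ha.mul hb) := by
  refine IntegralRep.ext' ?_ ?_
  · ext w
    simp only [IntegralRep.prod_domain, IntegralRep.mem_prodDomain, soloInformedConstRep_domain,
      mem_univ, true_and]
  · rw [IntegralRep.prod_integrand_eq]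
    funext w
    rw [IntegralRep.prodFun_apply, soloInformedConstRep_integrand, soloInformedConstRep_integrand,
      soloInformedConstRep_integrand]

/-- `[pt, a + b] − [pt, a] − [pt, b]` is an integrand-additivity relation. -/
theorem soloInformedConstRep_add_mem_relations (a b : ℝ) (ha : IsAlgebraic ℚ a)
    (hb : IsAlgebraic ℚ b) :
    of (soloInformedConstRep (a + b) (ha.add hb)) - of (soloInformedConstRep a ha) -
      of (soloInformedConstRep b hb) ∈ relations :=
  integrandAddRel_subset_relations
    ⟨0, soloInformedConstRep (a + b) (ha.add hb), soloInformedConstRep a ha, soloInformedConstRep b hb,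
      rfl, rfl, fun _ _ => rfl, rfl⟩

/-- `[σ, a • f] − [σ, f]`-type additivity: `[σ, (a + b) • f] − [σ, a • f] − [σ, b • f] ∈ relations`. -/
theorem soloInformedScaleRep_add_mem_relations {n : ℕ} (a b : ℝ) (ha : IsAlgebraic ℚ a)
    (hb : IsAlgebraic ℚ b) (r : IntegralRep n) :
    of (soloInformedScaleRep (a + b) (ha.add hb) r) - of (soloInformedScaleRep a ha r) -
      of (soloInformedScaleRep b hb r) ∈ relations :=
  integrandAddRel_subset_relations
    ⟨n, soloInformedScaleRep (a + b) (ha.add hb) r, soloInformedScaleRep a ha r,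
      soloInformedScaleRep b hb r, rfl, rfl, fun x _ => by simp [add_mul], rfl⟩

/-! ## 2. The algebra `P` over the real algebraic numbers -/

/-- The field of real algebraic numbers `F_ℝ = ℚ̄ ∩ ℝ` (as a type). -/
abbrev SoloInformedRealAlg : Type := ↥(algebraicClosure ℚ ℝ)

/-- The field of complex algebraic numbers `F_ℂ = ℚ̄ ⊂ ℂ` (as a type). -/
abbrev SoloInformedCxAlg : Type := ↥(algebraicClosure ℚ ℂ)

/-- Elements of `F_ℝ` are algebraic over `ℚ`. -/
theorem SoloInformedRealAlg.isAlgebraic (a : SoloInformedRealAlg) : IsAlgebraic ℚ (a : ℝ) :=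
  mem_algebraicClosure_iff.mp a.2
/-- Elements of `F_ℂ` are algebraic over `ℚ`. -/
theorem SoloInformedCxAlg.isAlgebraic (a : SoloInformedCxAlg) : IsAlgebraic ℚ (a : ℂ) :=
  mem_algebraicClosure_iff.mp a.2

/-- **The class `⟦[pt, a]⟧ ∈ P`** of a real algebraic number. -/
def soloInformedAlgScalar (a : SoloInformedRealAlg) : FormalPeriodRing :=
  toFormalPeriod (of (soloInformedConstRep (a : ℝ) a.isAlgebraic))

/-- Unfolding of `soloInformedAlgScalar`. -/
theorem soloInformedAlgScalar_def (a : SoloInformedRealAlg) :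
    soloInformedAlgScalar a = toFormalPeriod (of (soloInformedConstRep (a : ℝ) a.isAlgebraic)) := rfl

/-- Proof-irrelevance helper: the class of `[pt, a]` only depends on the real number `a`. -/
theorem soloInformed_toFormalPeriod_constRep_congr {a b : ℝ} (ha : IsAlgebraic ℚ a)
    (hb : IsAlgebraic ℚ b) (h : a = b) :
    toFormalPeriod (of (soloInformedConstRep a ha)) = toFormalPeriod (of (soloInformedConstRep b hb)) := by
  subst h; rfl

/-- `⟦[pt, 1]⟧ = 1` in `P`. -/
theorem soloInformedAlgScalar_one : soloInformedAlgScalar 1 = 1 := by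
  rw [soloInformedAlgScalar_def, ← toFormalPeriod_of_unit, ← soloInformedConstRep_one]
  exact soloInformed_toFormalPeriod_constRep_congr _ _ (by simp)

/-- `⟦[pt, a b]⟧ = ⟦[pt, a]⟧ · ⟦[pt, b]⟧` (Fubini product). [Kontsevich–Zagier 2001, §4.1] -/
theorem soloInformedAlgScalar_mul (a b : SoloInformedRealAlg) :
    soloInformedAlgScalar (a * b) = soloInformedAlgScalar a * soloInformedAlgScalar b := by
  rw [soloInformedAlgScalar_def, soloInformedAlgScalar_def, soloInformedAlgScalar_def,
    ← map_mul, of_mul_of, soloInformedConstRep_prod_constRep]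
  exact soloInformed_toFormalPeriod_constRep_congr _ _ (by simp)

/-- `⟦[pt, a + b]⟧ = ⟦[pt, a]⟧ + ⟦[pt, b]⟧` (integrand additivity). [Kontsevich–Zagier 2001, §1.2] -/
theorem soloInformedAlgScalar_add (a b : SoloInformedRealAlg) :
    soloInformedAlgScalar (a + b) = soloInformedAlgScalar a + soloInformedAlgScalar b := by
  have h := toFormalPeriod_eq_zero_of_mem
    (soloInformedConstRep_add_mem_relations (a : ℝ) (b : ℝ) a.isAlgebraic b.isAlgebraic)
  rw [map_sub, map_sub, sub_sub, sub_eq_zero] at h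
  rw [soloInformedAlgScalar_def, soloInformedAlgScalar_def, soloInformedAlgScalar_def, ← h]
  exact soloInformed_toFormalPeriod_constRep_congr _ _ (by simp)

/-- `⟦[pt, 0]⟧ = 0` in `P`. -/
theorem soloInformedAlgScalar_zero : soloInformedAlgScalar 0 = 0 := by
  have h := soloInformedAlgScalar_add 0 0
  rw [add_zero] at h
  have : soloInformedAlgScalar 0 + soloInformedAlgScalar 0 = soloInformedAlgScalar 0 + 0 := by
    rw [add_zero]; exact h.symm
  exact add_left_cancel this

/-- **The structure map `F_ℝ → P`, `a ↦ ⟦[pt, a]⟧`**, a ring homomorphism (its axioms are KZ moves: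
integrand additivity and the Fubini product). [Kontsevich–Zagier 2001, §4.1] -/
def soloInformedAlgScalarHom : SoloInformedRealAlg →+* FormalPeriodRing where
  toFun := soloInformedAlgScalar
  map_one' := soloInformedAlgScalar_one
  map_mul' := soloInformedAlgScalar_mul
  map_zero' := soloInformedAlgScalar_zero
  map_add' := soloInformedAlgScalar_add
/-- Unfolding of the structure map `F_ℝ → P`. -/
@[simp] theorem soloInformedAlgScalarHom_apply (a : SoloInformedRealAlg) :
    soloInformedAlgScalarHom a = soloInformedAlgScalar a := rfl

/-- `P` is an algebra over the real algebraic numbers. -/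
instance soloInformedAlgebraRealAlg : Algebra SoloInformedRealAlg FormalPeriodRing :=
  soloInformedAlgScalarHom.toAlgebra

/-- The algebra map `F_ℝ → P` is `a ↦ ⟦[pt, a]⟧`. -/
theorem soloInformed_algebraMap_eq (a : SoloInformedRealAlg) :
    algebraMap SoloInformedRealAlg FormalPeriodRing a = soloInformedAlgScalar a := rfl

/-- Scalar multiplication by `a ∈ F_ℝ` on `P` is multiplication by `⟦[pt, a]⟧`. -/
theorem soloInformed_smul_def (a : SoloInformedRealAlg) (x : FormalPeriodRing) :
    a • x = soloInformedAlgScalar a * x :=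
  Algebra.smul_def a x

/-- **Scaling an integrand is scalar multiplication in `P`**:
`a • ⟦[σ, f]⟧ = ⟦[σ, a • f]⟧` for a real algebraic number `a`
(`[pt, a] · [σ, f]` is a relabelling of `[σ, a • f]`, a change-of-variables move).
[Kontsevich–Zagier 2001, §1.2, §4.1] -/
theorem soloInformed_smul_toFormalPeriod_of {n : ℕ} (a : SoloInformedRealAlg) (r : IntegralRep n) :
    a • toFormalPeriod (of r) = toFormalPeriod (of (soloInformedScaleRep (a : ℝ) a.isAlgebraic r)) := by
  rw [soloInformed_smul_def, soloInformedAlgScalar_def, ← map_mul, of_mul_of,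
    soloInformedConstRep_prod_eq_reindex, toFormalPeriod_eq_iff, ← neg_sub]
  exact relations.neg_mem (of_sub_of_reindex_mem_relations _ _)

/-- Version with an arbitrary algebraicity witness. -/
theorem soloInformed_smul_toFormalPeriod_of' {n : ℕ} (a : SoloInformedRealAlg) {a' : ℝ}
    (ha' : IsAlgebraic ℚ a') (h : (a : ℝ) = a') (r : IntegralRep n) :
    a • toFormalPeriod (of r) = toFormalPeriod (of (soloInformedScaleRep a' ha' r)) := by
  subst h; exact soloInformed_smul_toFormalPeriod_of a r

/-! ## 3. The module `V = P × P` over the complex algebraic numbers -/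

/-- Real part of a complex algebraic number, as a real algebraic number. -/
def SoloInformedCxAlg.re (a : SoloInformedCxAlg) : SoloInformedRealAlg :=
  ⟨(a : ℂ).re, mem_algebraicClosure_iff.mpr (isAlgebraic_re_im a.isAlgebraic).1⟩

/-- Imaginary part of a complex algebraic number, as a real algebraic number. -/
def SoloInformedCxAlg.im (a : SoloInformedCxAlg) : SoloInformedRealAlg :=
  ⟨(a : ℂ).im, mem_algebraicClosure_iff.mpr (isAlgebraic_re_im a.isAlgebraic).2⟩
/-- Coercion of the real part (definitional). -/
@[simp] theorem SoloInformedCxAlg.coe_re (a : SoloInformedCxAlg) : (a.re : ℝ) = (a : ℂ).re := rfl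
/-- Coercion of the imaginary part (definitional). -/
@[simp] theorem SoloInformedCxAlg.coe_im (a : SoloInformedCxAlg) : (a.im : ℝ) = (a : ℂ).im := rfl
/-- `Re 1 = 1`. -/
@[simp] theorem SoloInformedCxAlg.re_one : (1 : SoloInformedCxAlg).re = 1 := Subtype.ext (by simp)
/-- `Im 1 = 0`. -/
@[simp] theorem SoloInformedCxAlg.im_one : (1 : SoloInformedCxAlg).im = 0 := Subtype.ext (by simp)
/-- `Re 0 = 0`. -/
@[simp] theorem SoloInformedCxAlg.re_zero : (0 : SoloInformedCxAlg).re = 0 := Subtype.ext (by simp)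
/-- `Im 0 = 0`. -/
@[simp] theorem SoloInformedCxAlg.im_zero : (0 : SoloInformedCxAlg).im = 0 := Subtype.ext (by simp)
/-- `Re` is additive. -/
theorem SoloInformedCxAlg.re_add (a b : SoloInformedCxAlg) : (a + b).re = a.re + b.re :=
  Subtype.ext (by simp)
/-- `Im` is additive. -/
theorem SoloInformedCxAlg.im_add (a b : SoloInformedCxAlg) : (a + b).im = a.im + b.im :=
  Subtype.ext (by simp)
/-- `Re (a b) = Re a Re b − Im a Im b`. -/
theorem SoloInformedCxAlg.re_mul (a b : SoloInformedCxAlg) : (a * b).re = a.re * b.re - a.im * b.im :=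
  Subtype.ext (by simp [Complex.mul_re])

/-- `Im (a b) = Re a Im b + Im a Re b`. -/
theorem SoloInformedCxAlg.im_mul (a b : SoloInformedCxAlg) : (a * b).im = a.re * b.im + a.im * b.re :=
  Subtype.ext (by simp [Complex.mul_im])

/-- **`V = P × P`**, the target of the functional `κ` (real and imaginary parts). A `def` (not an
`abbrev`), so that the `F_ℂ`-module structure below is the only one in sight. -/
def SoloInformedV : Type := FormalPeriodRing × FormalPeriodRing

/-- `V` is an additive commutative group (transferred from `P × P`). -/
instance SoloInformedV.instAddCommGroup : AddCommGroup SoloInformedV :=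
  inferInstanceAs (AddCommGroup (FormalPeriodRing × FormalPeriodRing))

/-- `V` is inhabited (by `0`). -/
instance SoloInformedV.instInhabited : Inhabited SoloInformedV := ⟨0⟩

namespace SoloInformedV

/-- Constructor. -/
def mk (u v : FormalPeriodRing) : SoloInformedV := (u, v)

/-- First ("real") component. -/
def fst (x : SoloInformedV) : FormalPeriodRing := Prod.fst x

/-- Second ("imaginary") component. -/
def snd (x : SoloInformedV) : FormalPeriodRing := Prod.snd x

/-- First component of `mk u v` (definitional). -/
@[simp] theorem fst_mk (u v : FormalPeriodRing) : (mk u v).fst = u := rfl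
/-- Second component of `mk u v` (definitional). -/
@[simp] theorem snd_mk (u v : FormalPeriodRing) : (mk u v).snd = v := rfl

/-- Extensionality for `V`: two elements with equal components are equal. -/
@[ext] theorem ext {x y : SoloInformedV} (h₁ : x.fst = y.fst) (h₂ : x.snd = y.snd) : x = y :=
  Prod.ext h₁ h₂

/-- `mk` of the components recovers the element (definitional). -/
theorem mk_fst_snd (x : SoloInformedV) : mk x.fst x.snd = x := rfl

/-- `fst` is additive. -/
@[simp] theorem fst_add (x y : SoloInformedV) : (x + y).fst = x.fst + y.fst := rfl
/-- `snd` is additive. -/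
@[simp] theorem snd_add (x y : SoloInformedV) : (x + y).snd = x.snd + y.snd := rfl
/-- `fst 0 = 0`. -/
@[simp] theorem fst_zero : (0 : SoloInformedV).fst = 0 := rfl
/-- `snd 0 = 0`. -/
@[simp] theorem snd_zero : (0 : SoloInformedV).snd = 0 := rfl
/-- `fst` commutes with negation. -/
@[simp] theorem fst_neg (x : SoloInformedV) : (-x).fst = -x.fst := rfl
/-- `snd` commutes with negation. -/
@[simp] theorem snd_neg (x : SoloInformedV) : (-x).snd = -x.snd := rfl
/-- `fst` commutes with subtraction. -/
@[simp] theorem fst_sub (x y : SoloInformedV) : (x - y).fst = x.fst - y.fst := rfl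
/-- `snd` commutes with subtraction. -/
@[simp] theorem snd_sub (x y : SoloInformedV) : (x - y).snd = x.snd - y.snd := rfl

/-- Addition in `V` is componentwise. -/
theorem mk_add_mk (u v u' v' : FormalPeriodRing) : mk u v + mk u' v' = mk (u + u') (v + v') := rfl

/-- `fst` commutes with finite sums. -/
@[simp] theorem fst_sum {ι : Type*} (s : Finset ι) (f : ι → SoloInformedV) :
    (∑ i ∈ s, f i).fst = ∑ i ∈ s, (f i).fst :=
  map_sum (AddMonoidHom.fst FormalPeriodRing FormalPeriodRing) f s

/-- `snd` commutes with finite sums. -/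
@[simp] theorem snd_sum {ι : Type*} (s : Finset ι) (f : ι → SoloInformedV) :
    (∑ i ∈ s, f i).snd = ∑ i ∈ s, (f i).snd :=
  map_sum (AddMonoidHom.snd FormalPeriodRing FormalPeriodRing) f s

/-- `fst` commutes with integer multiples. -/
@[simp] theorem fst_zsmul (n : ℤ) (x : SoloInformedV) : (n • x).fst = n • x.fst := rfl
/-- `snd` commutes with integer multiples. -/
@[simp] theorem snd_zsmul (n : ℤ) (x : SoloInformedV) : (n • x).snd = n • x.snd := rfl

/-- The complex-algebraic scalar action `a ⋆ (u, v) = (Re a • u − Im a • v, Im a • u + Re a • v)`. -/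
def cxSMul (a : SoloInformedCxAlg) (x : SoloInformedV) : SoloInformedV :=
  mk (a.re • x.fst - a.im • x.snd) (a.im • x.fst + a.re • x.snd)

/-- The scalar action of `F_ℂ` on `V`. -/
instance instSMul : SMul SoloInformedCxAlg SoloInformedV := ⟨cxSMul⟩

/-- Unfolding of the scalar action of `F_ℂ` on `V`. -/
theorem smul_def (a : SoloInformedCxAlg) (x : SoloInformedV) :
    a • x = mk (a.re • x.fst - a.im • x.snd) (a.im • x.fst + a.re • x.snd) := rfl

/-- First component of `a ⋆ x`: `Re a • x.fst − Im a • x.snd`. -/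
@[simp] theorem fst_smul (a : SoloInformedCxAlg) (x : SoloInformedV) :
    (a • x).fst = a.re • x.fst - a.im • x.snd := rfl

/-- Second component of `a ⋆ x`: `Im a • x.fst + Re a • x.snd`. -/
@[simp] theorem snd_smul (a : SoloInformedCxAlg) (x : SoloInformedV) :
    (a • x).snd = a.im • x.fst + a.re • x.snd := rfl

/-- **`V` is a module over the complex algebraic numbers.** -/
instance instModule : Module SoloInformedCxAlg SoloInformedV where
  one_smul x := by ext <;> simp
  mul_smul a b x := by
    ext
    · simp only [fst_smul, snd_smul, SoloInformedCxAlg.re_mul, SoloInformedCxAlg.im_mul, sub_smul,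
        add_smul, mul_smul, smul_sub, smul_add]
      abel
    · simp only [fst_smul, snd_smul, SoloInformedCxAlg.re_mul, SoloInformedCxAlg.im_mul, sub_smul,
        add_smul, mul_smul, smul_sub, smul_add]
      abel
  smul_zero a := by ext <;> simp
  smul_add a x y := by
    ext
    · simp only [fst_smul, fst_add, snd_add, smul_add]; abel
    · simp only [snd_smul, fst_add, snd_add, smul_add]; abel
  add_smul a b x := by
    ext
    · simp only [fst_smul, fst_add, SoloInformedCxAlg.re_add, SoloInformedCxAlg.im_add, add_smul]
      abel
    · simp only [snd_smul, snd_add, SoloInformedCxAlg.re_add, SoloInformedCxAlg.im_add, add_smul]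
      abel
  zero_smul x := by ext <;> simp

/-- A real algebraic scalar (imaginary part `0`) acts diagonally. -/
theorem smul_of_im_eq_zero (a : SoloInformedCxAlg) (ha : (a : ℂ).im = 0) (x : SoloInformedV) :
    a • x = mk (a.re • x.fst) (a.re • x.snd) := by
  have him : a.im = 0 := Subtype.ext (by simp [ha])
  ext <;> simp [him]

/-- An integer scalar acts as the integer multiple. -/
theorem intCast_smul (n : ℤ) (x : SoloInformedV) : ((n : SoloInformedCxAlg)) • x = n • x := by
  have hre : (n : SoloInformedCxAlg).re = (n : SoloInformedRealAlg) := Subtype.ext (by simp)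
  have him : (n : SoloInformedCxAlg).im = 0 := Subtype.ext (by simp)
  ext
  · rw [fst_smul, hre, him, zero_smul, sub_zero, fst_zsmul, Int.cast_smul_eq_zsmul]
  · rw [snd_smul, hre, him, zero_smul, zero_add, snd_zsmul, Int.cast_smul_eq_zsmul]

end SoloInformedV

end Summit.KontsevichZagierPeriods.KontsevichZagierPeriods.Theorems
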